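import Summits.KontsevichZagierPeriods.Zeta5Search.Barrier.ConeGammaLemmaFBoxSound
import Summits.KontsevichZagierPeriods.Zeta5Search.Barrier.ConeGammaLemmaF7

/-!
# ζ(5) search — BARRIER: the feature tables of F7 / F6 for the box checker, their IDENTITY with P2 g24's
# `phi30_le_boundF7` / `phi30_le_boundF6`, and the passage «box certificate ⇒ Φ(a) ≤ s₀·β on the box»

HONEST FRAMING (cell `pub-zeta5`): systematic search; no irrationality claim unless kernel-certified. MODEL-side objects
under Brown–Zudilin's (28)+(30) accounting ((28) observed, not proved): `Φ = phi30` and its closed-form separable-majorant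
bound `B_F7(t) = (1 + t₇) − Σ_m ε_m x_m log x_m` / `B_F6(t) = (1 + t₆) − Σ_m ε_m x_m log x_m` (cert-2 g32/g33's KERNEL
majorants `torusN_le_F7` / `_F6` through P2 g24's LEMMA F, `ConeGammaLemmaF7`). Nothing here is about C₀ / C₁ / δ₂₈ on
any box, hence NO γ-statement on any box; nothing about any γ of record, the cone's sup, C2 (OPEN), S-E (CONJECTURED),
(TD_A) or `ζ(5)`; records in print UNMOVED. Theory seat cert-2 g34 (item «LEMMA F NUMERICS IN THE KERNEL — POINTS AND
BOXES»), part 3/3a; the certificates themselves are `ConeGammaLemmaFBoxPoints` / `ConeGammaLemmaFBoxBoxes`.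

* `F7tab`, `top7`, `F6tab`, `top6` — the 18 / 17 oriented features `(ε_m, coefficients of x_m on (s₀,…,s₇))` in the
  TERM ORDER of `phi30_le_boundF7` / `phi30_le_boundF6`;
* **`boundF7_eq_bForm`**, **`boundF6_eq_bForm`** — the right-hand side of P2 g24's `phi30_aOfS_le_boundF7` / `_F6`,
  VERBATIM, equals `bForm F7tab top7 s` / `bForm F6tab top6 s` (so the tables are the tree's feature lists, checked by
  the kernel, not re-typed on trust; uses `x·log(H/x) = x log H − x log x` and the cancellation `Σ_m ε_m x_m = 0`);
* **`phi30_le_mul_of_bForm7_le`** / **`…bForm6_le`** — for `a` in the closed box on the F7- (F6-) chamber, any bound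
  `bForm (s(a)/s₀) ≤ β` gives `Φ(a) ≤ s₀·β` (homogeneity `phi30_smul` + P2 g24's theorem at the normalised direction);
* **`phi30_le_of_boxCheckF7`** / **`…F6`** — `boxCheck … D lo hi p q = true` ⇒ `Φ(a) ≤ s₀·(p/q)` for EVERY real
  direction `a` of the closed box and chamber with `lo_i ≤ D·s_i(a)/s₀(a) ≤ hi_i`; `chamber7` / `chamber6` read the
  chamber off the box data.
-/

open Finset Set
open Literature.Analysis.ValidatedNumerics.NumericsMP

namespace Summit.KontsevichZagierPeriods.Zeta5Search.Barrier.ConeGamma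

namespace LemmaFBox

/-! ### The feature tables (term order of `ConeGammaLemmaF7`) -/

/-- F7 = G(7,1) − W(P₀): `(ε_m, m)` for the 18 terms of `phi30_le_boundF7`, `m` as coefficients on `(s₀,…,s₇)`. -/
def F7tab : List (ℤ × List ℤ) :=
  [(1, [1,0,0,0,0,0,0,1]), (1, [0,1,0,0,0,0,1,0]), (1, [0,0,0,1,0,1,0,0]), (1, [0,0,0,0,1,1,0,0]),
   (1, [0,0,0,0,1,0,1,0]), (1, [1,0,0,0,0,0,0,-1]), (1, [0,0,-1,0,0,0,0,1]), (1, [0,0,0,-1,0,0,0,1]),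
   (1, [0,0,0,0,-1,0,0,1]), (1, [0,0,0,0,0,-1,0,1]), (1, [0,0,0,0,0,0,-1,1]), (-1, [0,1,0,0,0,0,0,1]),
   (-1, [0,0,0,1,0,0,0,1]), (-1, [0,0,0,0,1,0,0,1]), (-1, [0,0,0,0,0,1,0,1]), (-1, [0,0,0,0,0,0,1,1]),
   (-1, [1,0,-1,0,0,0,0,0]), (-1, [1,0,0,-1,0,0,0,0])]

/-- The top feature `s₀ + s₇` of F7. -/
def top7 : List ℤ := [1,0,0,0,0,0,0,1]

/-- F6 = G(6,7) − W(P₀): `(ε_m, m)` for the 17 terms of `phi30_le_boundF6` (`−2` on `s₆ + s₇`). -/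
def F6tab : List (ℤ × List ℤ) :=
  [(1, [1,0,0,0,0,0,1,0]), (1, [0,1,0,0,0,0,0,1]), (1, [0,0,1,0,0,0,0,1]), (1, [0,0,0,1,0,1,0,0]),
   (1, [0,0,0,0,1,1,0,0]), (1, [1,0,0,0,0,0,-1,0]), (1, [0,-1,0,0,0,0,1,0]), (1, [0,0,-1,0,0,0,1,0]),
   (1, [0,0,0,-1,0,0,1,0]), (1, [0,0,0,0,-1,0,1,0]), (1, [0,0,0,0,0,-1,1,0]), (-1, [0,0,1,0,0,0,1,0]),
   (-1, [0,0,0,1,0,0,1,0]), (-1, [0,0,0,0,0,1,1,0]), (-2, [0,0,0,0,0,0,1,1]), (-1, [1,0,-1,0,0,0,0,0]),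
   (-1, [1,0,0,-1,0,0,0,0])]

/-- The top feature `s₀ + s₆` of F6. -/
def top6 : List ℤ := [1,0,0,0,0,0,1,0]

/-- The F7 chamber read off box data: `hi_i ≤ lo_7` for `i = 2,…,6` (so `s_i ≤ s_7` on the box). -/
def chamber7 (lo hi : List ℕ) : Bool :=
  [2,3,4,5,6].all fun i => decide (hi.getD i 0 ≤ lo.getD 7 0)

/-- The F6 chamber read off box data: `hi_i ≤ lo_6` for `i = 1,…,5`. -/
def chamber6 (lo hi : List ℕ) : Bool :=
  [1,2,3,4,5].all fun i => decide (hi.getD i 0 ≤ lo.getD 6 0)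

/-! ### The tables ARE P2 g24's feature lists -/

/-- `x·log(H/x) = x·log H − x·log x` (`H ≠ 0`; both sides vanish at `x = 0`). -/
theorem mul_log_div_eq (H x : ℝ) (hH : H ≠ 0) : x * Real.log (H / x) = x * Real.log H - x * Real.log x := by
  rcases eq_or_ne x 0 with rfl | hx
  · simp
  · rw [Real.log_div hH hx]; ring

/-- **The right-hand side of `phi30_aOfS_le_boundF7`, verbatim, is `bForm F7tab top7 s`.** -/
theorem boundF7_eq_bForm (s : Fin 8 → ℝ) (hH : s 0 + s 7 ≠ 0) :
    (s 0 + s 7)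
      + (s 0 + s 7) * Real.log ((s 0 + s 7) / (s 0 + s 7)) + (s 1 + s 6) * Real.log ((s 0 + s 7) / (s 1 + s 6))
      + (s 3 + s 5) * Real.log ((s 0 + s 7) / (s 3 + s 5)) + (s 4 + s 5) * Real.log ((s 0 + s 7) / (s 4 + s 5))
      + (s 4 + s 6) * Real.log ((s 0 + s 7) / (s 4 + s 6)) + (s 0 - s 7) * Real.log ((s 0 + s 7) / (s 0 - s 7))
      + (s 7 - s 2) * Real.log ((s 0 + s 7) / (s 7 - s 2)) + (s 7 - s 3) * Real.log ((s 0 + s 7) / (s 7 - s 3))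
      + (s 7 - s 4) * Real.log ((s 0 + s 7) / (s 7 - s 4)) + (s 7 - s 5) * Real.log ((s 0 + s 7) / (s 7 - s 5))
      + (s 7 - s 6) * Real.log ((s 0 + s 7) / (s 7 - s 6))
      - (s 1 + s 7) * Real.log ((s 0 + s 7) / (s 1 + s 7)) - (s 3 + s 7) * Real.log ((s 0 + s 7) / (s 3 + s 7))
      - (s 4 + s 7) * Real.log ((s 0 + s 7) / (s 4 + s 7)) - (s 5 + s 7) * Real.log ((s 0 + s 7) / (s 5 + s 7))
      - (s 6 + s 7) * Real.log ((s 0 + s 7) / (s 6 + s 7)) - (s 0 - s 2) * Real.log ((s 0 + s 7) / (s 0 - s 2))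
      - (s 0 - s 3) * Real.log ((s 0 + s 7) / (s 0 - s 3))
    = bForm F7tab top7 s := by
  simp only [mul_log_div_eq _ _ hH]
  simp [bForm, entF, F7tab, top7, featVal, coef, Fin.sum_univ_eight]
  ring_nf

/-- **The right-hand side of `phi30_aOfS_le_boundF6`, verbatim, is `bForm F6tab top6 s`.** -/
theorem boundF6_eq_bForm (s : Fin 8 → ℝ) (hH : s 0 + s 6 ≠ 0) :
    (s 0 + s 6)
      + (s 0 + s 6) * Real.log ((s 0 + s 6) / (s 0 + s 6)) + (s 1 + s 7) * Real.log ((s 0 + s 6) / (s 1 + s 7))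
      + (s 2 + s 7) * Real.log ((s 0 + s 6) / (s 2 + s 7)) + (s 3 + s 5) * Real.log ((s 0 + s 6) / (s 3 + s 5))
      + (s 4 + s 5) * Real.log ((s 0 + s 6) / (s 4 + s 5)) + (s 0 - s 6) * Real.log ((s 0 + s 6) / (s 0 - s 6))
      + (s 6 - s 1) * Real.log ((s 0 + s 6) / (s 6 - s 1)) + (s 6 - s 2) * Real.log ((s 0 + s 6) / (s 6 - s 2))
      + (s 6 - s 3) * Real.log ((s 0 + s 6) / (s 6 - s 3)) + (s 6 - s 4) * Real.log ((s 0 + s 6) / (s 6 - s 4))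
      + (s 6 - s 5) * Real.log ((s 0 + s 6) / (s 6 - s 5))
      - (s 2 + s 6) * Real.log ((s 0 + s 6) / (s 2 + s 6)) - (s 3 + s 6) * Real.log ((s 0 + s 6) / (s 3 + s 6))
      - (s 5 + s 6) * Real.log ((s 0 + s 6) / (s 5 + s 6)) - 2 * ((s 6 + s 7) * Real.log ((s 0 + s 6) / (s 6 + s 7)))
      - (s 0 - s 2) * Real.log ((s 0 + s 6) / (s 0 - s 2)) - (s 0 - s 3) * Real.log ((s 0 + s 6) / (s 0 - s 3))
    = bForm F6tab top6 s := by
  simp only [mul_log_div_eq _ _ hH]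
  simp [bForm, entF, F6tab, top6, featVal, coef, Fin.sum_univ_eight]
  ring_nf

/-! ### From a bound on `bForm` at the normalised direction to a bound on `Φ` -/

/-- The normalised direction `t = s(a)/s₀`. -/
theorem aOfS_normalise {a : Dir} (ha : BZBox a) :
    a = sParam a 0 • aOfS (fun i => sParam a i / sParam a 0) := by
  have h0 : sParam a 0 ≠ 0 := ha.1.ne'
  conv_lhs => rw [← aOfS_sParam a]
  rw [← aOfS_smul]
  congr 1
  funext i
  simp only [Pi.smul_apply, smul_eq_mul]
  field_simp

/-- **F7: a bound on `bForm F7tab top7` at `t = s(a)/s₀` bounds `Φ(a)/s₀`** (P2 g24's `phi30_aOfS_le_boundF7` at the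
normalised direction + `phi30_smul`). -/
theorem phi30_le_mul_of_bForm7_le {a : Dir} (ha : BZBox a) (h2 : sParam a 2 ≤ sParam a 7)
    (h3 : sParam a 3 ≤ sParam a 7) (h4 : sParam a 4 ≤ sParam a 7) (h5 : sParam a 5 ≤ sParam a 7)
    (h6 : sParam a 6 ≤ sParam a 7) {β : ℝ} (hB : bForm F7tab top7 (fun i => sParam a i / sParam a 0) ≤ β) :
    phi30 a ≤ sParam a 0 * β := by
  have h0 : 0 < sParam a 0 := ha.1
  set t : Fin 8 → ℝ := fun i => sParam a i / sParam a 0 with ht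
  have ht0 : t 0 = 1 := by simp [ht, h0.ne']
  have hlo : ∀ j : Fin 7, 0 ≤ t j.succ := fun j => div_nonneg (ha.2 j).1 h0.le
  have hhi : ∀ j : Fin 7, t j.succ ≤ t 0 := fun j => by
    rw [ht0]; exact (div_le_one h0).mpr (ha.2 j).2
  have hmono : ∀ {i j : Fin 8}, sParam a i ≤ sParam a j → t i ≤ t j := fun h =>
    div_le_div_of_nonneg_right h h0.le
  have hP := phi30_aOfS_le_boundF7 t (by rw [ht0]; exact one_pos) hlo hhi (hmono h2) (hmono h3) (hmono h4)
    (hmono h5) (hmono h6)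
  have hH : t 0 + t 7 ≠ 0 := by
    have : 0 ≤ t 7 := hlo 6
    rw [ht0]; positivity
  rw [boundF7_eq_bForm t hH] at hP
  have e : phi30 a = sParam a 0 * phi30 (aOfS t) := by
    conv_lhs => rw [aOfS_normalise ha]
    rw [phi30_smul h0]
  rw [e]
  exact mul_le_mul_of_nonneg_left (hP.trans hB) h0.le

/-- **F6: a bound on `bForm F6tab top6` at `t = s(a)/s₀` bounds `Φ(a)/s₀`.** -/
theorem phi30_le_mul_of_bForm6_le {a : Dir} (ha : BZBox a) (h1 : sParam a 1 ≤ sParam a 6)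
    (h2 : sParam a 2 ≤ sParam a 6) (h3 : sParam a 3 ≤ sParam a 6) (h4 : sParam a 4 ≤ sParam a 6)
    (h5 : sParam a 5 ≤ sParam a 6) {β : ℝ} (hB : bForm F6tab top6 (fun i => sParam a i / sParam a 0) ≤ β) :
    phi30 a ≤ sParam a 0 * β := by
  have h0 : 0 < sParam a 0 := ha.1
  set t : Fin 8 → ℝ := fun i => sParam a i / sParam a 0 with ht
  have ht0 : t 0 = 1 := by simp [ht, h0.ne']
  have hlo : ∀ j : Fin 7, 0 ≤ t j.succ := fun j => div_nonneg (ha.2 j).1 h0.le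
  have hhi : ∀ j : Fin 7, t j.succ ≤ t 0 := fun j => by
    rw [ht0]; exact (div_le_one h0).mpr (ha.2 j).2
  have hmono : ∀ {i j : Fin 8}, sParam a i ≤ sParam a j → t i ≤ t j := fun h =>
    div_le_div_of_nonneg_right h h0.le
  have hP := phi30_aOfS_le_boundF6 t (by rw [ht0]; exact one_pos) hlo hhi (hmono h1) (hmono h2) (hmono h3)
    (hmono h4) (hmono h5)
  have hH : t 0 + t 6 ≠ 0 := by
    have : 0 ≤ t 6 := hlo 5
    rw [ht0]; positivity
  rw [boundF6_eq_bForm t hH] at hP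
  have e : phi30 a = sParam a 0 * phi30 (aOfS t) := by
    conv_lhs => rw [aOfS_normalise ha]
    rw [phi30_smul h0]
  rw [e]
  exact mul_le_mul_of_nonneg_left (hP.trans hB) h0.le

/-! ### Box certificates ⇒ bounds for `Φ` on the box -/

/-- The chamber inequalities follow from the box data. -/
theorem le_of_box {D : ℕ} (hD : 0 < D) {lo hi : List ℕ} {t : Fin 8 → ℝ}
    (ht : ∀ i : Fin 8, ((lo.getD i 0 : ℕ) : ℝ) ≤ t i * D ∧ t i * D ≤ ((hi.getD i 0 : ℕ) : ℝ)) {i j : Fin 8}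
    (h : hi.getD i 0 ≤ lo.getD j 0) : t i ≤ t j := by
  have hD' : (0 : ℝ) < D := by exact_mod_cast hD
  have h' : ((hi.getD i 0 : ℕ) : ℝ) ≤ ((lo.getD j 0 : ℕ) : ℝ) := by exact_mod_cast h
  nlinarith [(ht i).2, (ht j).1]

/-- **KERNEL BOX BOUND FOR Φ (F7).** If `boxCheck F7tab top7 D lo hi p q = true` and the box lies in the F7 chamber
(`chamber7`), then `Φ(a) ≤ s₀(a)·(p/q)` for EVERY real direction `a` of the closed box with `lo_i ≤ D·s_i(a)/s₀(a) ≤ hi_i`. -/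
theorem phi30_le_of_boxCheckF7 {D : ℕ} {lo hi : List ℕ} {p : ℤ} {q : ℕ}
    (hc : boxCheck F7tab top7 D lo hi p q = true) (hch : chamber7 lo hi = true) {a : Dir} (ha : BZBox a)
    (ht : ∀ i : Fin 8, ((lo.getD i 0 : ℕ) : ℝ) ≤ sParam a i / sParam a 0 * D ∧
      sParam a i / sParam a 0 * D ≤ ((hi.getD i 0 : ℕ) : ℝ)) :
    phi30 a ≤ sParam a 0 * ((p : ℝ) / q) := by
  have hD : 0 < D := by
    simp only [boxCheck, Bool.and_eq_true] at hc
    exact (boxOK_spec hc.1.1).1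
  have h0 : 0 < sParam a 0 := ha.1
  simp only [chamber7, List.all_cons, List.all_nil, Bool.and_true, Bool.and_eq_true, decide_eq_true_eq] at hch
  obtain ⟨c2, c3, c4, c5, c6⟩ := hch
  have back : ∀ {i j : Fin 8}, sParam a i / sParam a 0 ≤ sParam a j / sParam a 0 → sParam a i ≤ sParam a j :=
    fun h => by rwa [div_le_div_iff_of_pos_right h0] at h
  exact phi30_le_mul_of_bForm7_le ha (back (le_of_box hD ht (i := 2) (j := 7) c2))
    (back (le_of_box hD ht (i := 3) (j := 7) c3)) (back (le_of_box hD ht (i := 4) (j := 7) c4))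
    (back (le_of_box hD ht (i := 5) (j := 7) c5)) (back (le_of_box hD ht (i := 6) (j := 7) c6))
    (bForm_le_of_boxCheck hc ht)

/-- **KERNEL BOX BOUND FOR Φ (F6).** -/
theorem phi30_le_of_boxCheckF6 {D : ℕ} {lo hi : List ℕ} {p : ℤ} {q : ℕ}
    (hc : boxCheck F6tab top6 D lo hi p q = true) (hch : chamber6 lo hi = true) {a : Dir} (ha : BZBox a)
    (ht : ∀ i : Fin 8, ((lo.getD i 0 : ℕ) : ℝ) ≤ sParam a i / sParam a 0 * D ∧
      sParam a i / sParam a 0 * D ≤ ((hi.getD i 0 : ℕ) : ℝ)) :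
    phi30 a ≤ sParam a 0 * ((p : ℝ) / q) := by
  have hD : 0 < D := by
    simp only [boxCheck, Bool.and_eq_true] at hc
    exact (boxOK_spec hc.1.1).1
  have h0 : 0 < sParam a 0 := ha.1
  simp only [chamber6, List.all_cons, List.all_nil, Bool.and_true, Bool.and_eq_true, decide_eq_true_eq] at hch
  obtain ⟨c1, c2, c3, c4, c5⟩ := hch
  have back : ∀ {i j : Fin 8}, sParam a i / sParam a 0 ≤ sParam a j / sParam a 0 → sParam a i ≤ sParam a j :=
    fun h => by rwa [div_le_div_iff_of_pos_right h0] at h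
  exact phi30_le_mul_of_bForm6_le ha (back (le_of_box hD ht (i := 1) (j := 6) c1))
    (back (le_of_box hD ht (i := 2) (j := 6) c2)) (back (le_of_box hD ht (i := 3) (j := 6) c3))
    (back (le_of_box hD ht (i := 4) (j := 6) c4)) (back (le_of_box hD ht (i := 5) (j := 6) c5))
    (bForm_le_of_boxCheck hc ht)

/-- **KERNEL POINT BOUND FOR Φ (F7)**: from a two-sided point certificate at `t = s(a)/s₀ = pt/D`. -/
theorem phi30_le_of_pointCheckF7 {D : ℕ} {pt : List ℕ} {pl pu : ℤ} {q : ℕ}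
    (hc : pointCheck F7tab top7 D pt pl pu q = true) {a : Dir} (ha : BZBox a) (h2 : sParam a 2 ≤ sParam a 7)
    (h3 : sParam a 3 ≤ sParam a 7) (h4 : sParam a 4 ≤ sParam a 7) (h5 : sParam a 5 ≤ sParam a 7)
    (h6 : sParam a 6 ≤ sParam a 7) (ht : ∀ i : Fin 8, sParam a i / sParam a 0 * D = ((pt.getD i 0 : ℕ) : ℝ)) :
    phi30 a ≤ sParam a 0 * ((pu : ℝ) / q) :=
  phi30_le_mul_of_bForm7_le ha h2 h3 h4 h5 h6 (bForm_mem_of_pointCheck hc ht).2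

/-- **KERNEL POINT BOUND FOR Φ (F6).** -/
theorem phi30_le_of_pointCheckF6 {D : ℕ} {pt : List ℕ} {pl pu : ℤ} {q : ℕ}
    (hc : pointCheck F6tab top6 D pt pl pu q = true) {a : Dir} (ha : BZBox a) (h1 : sParam a 1 ≤ sParam a 6)
    (h2 : sParam a 2 ≤ sParam a 6) (h3 : sParam a 3 ≤ sParam a 6) (h4 : sParam a 4 ≤ sParam a 6)
    (h5 : sParam a 5 ≤ sParam a 6) (ht : ∀ i : Fin 8, sParam a i / sParam a 0 * D = ((pt.getD i 0 : ℕ) : ℝ)) :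
    phi30 a ≤ sParam a 0 * ((pu : ℝ) / q) :=
  phi30_le_mul_of_bForm6_le ha h1 h2 h3 h4 h5 (bForm_mem_of_pointCheck hc ht).2

end LemmaFBox

end Summit.KontsevichZagierPeriods.Zeta5Search.Barrier.ConeGamma
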